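import Mathlib
import Literature.NumberTheory.Sieve.LinearPairKloostermanPiece
import Literature.NumberTheory.Sieve.LinearPairMoebiusMainTerm
import Literature.NumberTheory.Sieve.FriedlanderIwaniecPrimesSeparationLemma
import HarnessLib

/-!
# Exponential sums over pairs of moduli of a pair of linear congruences: a dyadic box

Topic `Literature/NumberTheory/Sieve` (continuation of `LinearPairKloostermanPiece.lean`).  With the
data `q₁ = r q̃`, `gcd(q̃, r q₀) = 1`, `r ∣ q₀^s`, `gcd(qᵢ, aᵢ) = 1`, `Δ = q₁a₀ − q₀a₁ ≠ 0`, `D = |Δ|`,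
a solution map `ν` of the pair `d₀ ∣ q₀ν + a₀`, `d₁ ∣ q₁ν + a₁`, an integer `k` with `kΔ ≠ 0`, a real
`y` and complex weights `g₀`, `g₁` (`g₁` supported on squarefree numbers), the BOX SUM

  `B = Σ_{A < d₀ ≤ 2A} Σ_{C < d₁ ≤ 2C} [pair (d₀,d₁) solvable] g₀(d₀) g₁(d₁) e(k (y − ν)/lcm(d₀,d₁))`

is decomposed according to `e = gcd(d₀, d₁) ∣ D` and the classes of `d₀`, `d₁/e` modulo `r` into
the pieces of `LinearPairKloostermanPiece.lean` (`box_eq_sum_pieces`), whence, by the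
Duke–Friedlander–Iwaniec bound for each piece (`norm_piece_le`),

  `‖B‖ ≤ τ(D) r² K G₀ G₁ √A √(2C) (1 + |k|(|y| + |a₀|)D/(AC)) (|k|D + q₀q₁AC)^{3/8} (q₀q₁(A + C))^{11/48+ε}`

(`norm_boxSum_le`, `|gᵢ| ≤ Gᵢ`, `A ≥ 1`, `C ≥ D`).  Finally the product condition
`Y' < d₀d₁ ≤ Y` of a divisor window is separated by the Duke–Friedlander–Iwaniec / Friedlander–Iwaniec
integral `[m ≤ Y] = ∫ h_Y(t) m^{it} dt`, `∫|h_Y| < log 6Y` (`FriedlanderIwaniecPrimes.lemma261`):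
the twisted weights `gᵢ(d) d^{it}` have the same size, so the windowed box sum is at most
`(log 6Y + log 6Y')` times the bound above (`norm_windowBoxSum_le`).  Everything here is PROVED.

## References

* W. Duke, J. Friedlander, H. Iwaniec, *Bilinear forms with Kloosterman fractions*, Invent. Math.
  128 (1997), 23–43, Theorem 2 and Lemma 9. [folklore]
-/

open Finset Real MeasureTheory

namespace Literature.NumberTheory.Sieve.LinearPairKloosterman

open Literature.NumberTheory.Sieve.LinearCongruencePair
open Literature.NumberTheory.Sieve.LinearPairMoebius (mul_mem_Ioc_iff)

section Box

variable {q₀ qt r s : ℕ} {a₀ a₁ : ℤ}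

/-- A product inequality with six nonnegative factors. [folklore] -/
theorem mul6_le {K a b c d f A' B' C' D' F' p q : ℝ} (hK : 0 ≤ K) (ha : 0 ≤ a) (hb : 0 ≤ b)
    (hc : 0 ≤ c) (hd : 0 ≤ d) (hf : 0 ≤ f) (hp : 0 ≤ p) (hq : 0 ≤ q) (h1 : a ≤ A') (h2 : b ≤ B')
    (h3 : c ≤ C') (h4 : d ≤ D') (h5 : f ≤ F') :
    K * a * b * c * d ^ p * f ^ q ≤ K * A' * B' * C' * D' ^ p * F' ^ q := by
  have hA : 0 ≤ A' := ha.trans h1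
  have hB : 0 ≤ B' := hb.trans h2
  have hC : 0 ≤ C' := hc.trans h3
  have hD : 0 ≤ D' := hd.trans h4
  have h2' : 0 ≤ K * A' * B' := mul_nonneg (mul_nonneg hK hA) hB
  have h3' : 0 ≤ K * A' * B' * C' := mul_nonneg h2' hC
  have h4' : 0 ≤ K * A' * B' * C' * D' ^ p := mul_nonneg h3' (Real.rpow_nonneg hD p)
  refine mul_le_mul (mul_le_mul (mul_le_mul (mul_le_mul (mul_le_mul_of_nonneg_left h1 hK) h2 hb
    (mul_nonneg hK hA)) h3 hc h2') (Real.rpow_le_rpow hd h4 hp) (Real.rpow_nonneg hd p)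
    h3') (Real.rpow_le_rpow hf h5 hq) (Real.rpow_nonneg hf q) h4'

/-- Splitting a sum over `d` according to the residue of `d` modulo `r ≥ 1`. [folklore] -/
theorem sum_eq_sum_range_filter_mod {E : Type*} [AddCommMonoid E] {r : ℕ} (hr : 0 < r)
    (S : Finset ℕ) (f : ℕ → E) :
    ∑ d ∈ S, f d = ∑ c ∈ Finset.range r, ∑ d ∈ S.filter (fun d => d % r = c), f d := by
  classical
  rw [Finset.sum_fiberwise_of_maps_to]
  intro d _
  exact Finset.mem_range.2 (Nat.mod_lt d hr)

/-- The dictionary of `coprime_of_sol` / `sol_of_coprime` at the level of indicators: for a weight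
`G` vanishing unless `e d₁'` is squarefree,
`[gcd(d₀, ed₁') = e ∧ Sol(d₀, ed₁')] G = [e ∣ d₀ ∧ gcd(e,q₁)=1 ∧ gcd(d₁',r)=1 ∧ gcd(q̃d₀, rq₀d₁')=1] G`.
[folklore] -/
theorem ite_gcd_sol_eq {e d₀ d₁' : ℕ} {Δ : ℤ} (hqt : Nat.Coprime qt (r * q₀)) (hrs : r ∣ q₀ ^ s)
    (heΔ : (e : ℤ) ∣ Δ) {G : ℂ} (hG : G ≠ 0 → Squarefree (e * d₁')) :
    (if (Nat.gcd d₀ (e * d₁') = e ∧ (Nat.Coprime d₀ q₀ ∧ Nat.Coprime (e * d₁') (r * qt) ∧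
        ((Nat.gcd d₀ (e * d₁') : ℕ) : ℤ) ∣ Δ)) then G else 0) =
      if (e ∣ d₀ ∧ Nat.Coprime e (r * qt) ∧ Nat.Coprime d₁' r ∧
        Nat.Coprime (qt * d₀) (r * q₀ * d₁')) then G else 0 := by
  by_cases hG0 : G = 0
  · simp [hG0]
  have hsq := hG hG0
  by_cases h : Nat.gcd d₀ (e * d₁') = e ∧ (Nat.Coprime d₀ q₀ ∧ Nat.Coprime (e * d₁') (r * qt) ∧
      ((Nat.gcd d₀ (e * d₁') : ℕ) : ℤ) ∣ Δ)
  · rw [if_pos h, if_pos (coprime_of_sol hsq hqt hrs h.1 h.2.1 h.2.2.1 h.2.2.2)]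
  · rw [if_neg h, if_neg]
    rintro ⟨h1, h2, h3, h4⟩
    exact h (sol_of_coprime h1 h2 h3 heΔ h4)

/-- **Decomposition of the box sum into pieces.**  Grouping by `e = gcd(d₀, d₁)` (a divisor of
`D = |Δ|` on the solvable pairs), writing `d₁ = e d₁'` and splitting `d₀`, `d₁'` into classes modulo
`r`, the box sum is `Σ_{e ∣ D, gcd(e,q₁)=1} Σ_{c₀, c₁ mod r} piece(e, c₀, c₁)` with the pieces of
`LinearPairKloostermanPiece.piece_eq`. [folklore] -/
theorem box_eq_sum_pieces (hr : 0 < r) (hqt : Nat.Coprime qt (r * q₀)) (hrs : r ∣ q₀ ^ s)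
    {Δ : ℤ} (hΔ : Δ ≠ 0)
    (A C : ℕ) (g₀ g₁ : ℕ → ℂ) (hg₁ : ∀ d, g₁ d ≠ 0 → Squarefree d) (Z : ℕ → ℕ → ℂ) :
    ∑ d₀ ∈ Ioc A (2 * A), ∑ d₁ ∈ Ioc C (2 * C),
        (if (Nat.Coprime d₀ q₀ ∧ Nat.Coprime d₁ (r * qt) ∧ ((Nat.gcd d₀ d₁ : ℕ) : ℤ) ∣ Δ) then
          g₀ d₀ * g₁ d₁ * Z d₀ d₁ else 0) =
      ∑ e ∈ Δ.natAbs.divisors, if Nat.Coprime e (r * qt) then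
        ∑ c₀ ∈ Finset.range r, ∑ c₁ ∈ Finset.range r,
          ∑ d₀ ∈ (Ioc A (2 * A)).filter (fun d => e ∣ d ∧ d % r = c₀),
            ∑ d₁' ∈ (Ioc (C / e) (2 * C / e)).filter (fun d => d % r = c₁ ∧ Nat.Coprime d r),
              (if Nat.Coprime (qt * d₀) (r * q₀ * d₁') then
                g₀ d₀ * g₁ (e * d₁') * Z d₀ (e * d₁') else 0)
        else 0 := by
  classical
  set D : ℕ := Δ.natAbs with hDdef
  have hD : D ≠ 0 := Int.natAbs_ne_zero.2 hΔ
  -- Step 1: insert `Σ_{e ∣ D} [gcd = e]`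
  have step1 : ∀ d₀ ∈ Ioc A (2 * A), ∀ d₁ ∈ Ioc C (2 * C),
      (if (Nat.Coprime d₀ q₀ ∧ Nat.Coprime d₁ (r * qt) ∧ ((Nat.gcd d₀ d₁ : ℕ) : ℤ) ∣ Δ) then
          g₀ d₀ * g₁ d₁ * Z d₀ d₁ else 0) =
        ∑ e ∈ D.divisors, (if (Nat.gcd d₀ d₁ = e ∧ (Nat.Coprime d₀ q₀ ∧ Nat.Coprime d₁ (r * qt) ∧
          ((Nat.gcd d₀ d₁ : ℕ) : ℤ) ∣ Δ)) then g₀ d₀ * g₁ d₁ * Z d₀ d₁ else 0) := by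
    intro d₀ _ d₁ _
    by_cases h : Nat.Coprime d₀ q₀ ∧ Nat.Coprime d₁ (r * qt) ∧ ((Nat.gcd d₀ d₁ : ℕ) : ℤ) ∣ Δ
    · rw [if_pos h]
      have hmem : Nat.gcd d₀ d₁ ∈ D.divisors := by
        rw [Nat.mem_divisors]
        exact ⟨by rw [hDdef]; exact Int.natCast_dvd.1 h.2.2, hD⟩
      rw [Finset.sum_eq_single_of_mem _ hmem]
      · rw [if_pos ⟨rfl, h⟩]
      · intro e _ hne
        rw [if_neg]
        rintro ⟨h1, -⟩
        exact hne h1.symm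
    · rw [if_neg h]
      symm
      refine Finset.sum_eq_zero fun e _ => ?_
      rw [if_neg]
      rintro ⟨-, h2⟩
      exact h h2
  rw [Finset.sum_congr rfl fun d₀ hd₀ => Finset.sum_congr rfl fun d₁ hd₁ => step1 d₀ hd₀ d₁ hd₁]
  rw [Finset.sum_congr rfl fun d₀ _ => Finset.sum_comm, Finset.sum_comm]
  refine Finset.sum_congr rfl fun e he => ?_
  have he0 : 0 < e := Nat.pos_of_mem_divisors he
  have heD : e ∣ D := Nat.dvd_of_mem_divisors he
  have heΔ : (e : ℤ) ∣ Δ := by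
    rw [hDdef] at heD
    exact Int.natCast_dvd.2 heD
  -- Step 2: for fixed `d₀`, restrict to `e ∣ d₁` and reindex `d₁ = e d₁'`
  have step2 : ∀ d₀ ∈ Ioc A (2 * A),
      ∑ d₁ ∈ Ioc C (2 * C), (if (Nat.gcd d₀ d₁ = e ∧ (Nat.Coprime d₀ q₀ ∧
          Nat.Coprime d₁ (r * qt) ∧ ((Nat.gcd d₀ d₁ : ℕ) : ℤ) ∣ Δ)) then
            g₀ d₀ * g₁ d₁ * Z d₀ d₁ else 0) =
        ∑ d₁' ∈ Ioc (C / e) (2 * C / e),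
          (if (e ∣ d₀ ∧ Nat.Coprime e (r * qt) ∧ Nat.Coprime d₁' r ∧
              Nat.Coprime (qt * d₀) (r * q₀ * d₁')) then
            g₀ d₀ * g₁ (e * d₁') * Z d₀ (e * d₁') else 0) := by
    intro d₀ _
    have hsupp : ∑ d₁ ∈ Ioc C (2 * C), (if (Nat.gcd d₀ d₁ = e ∧ (Nat.Coprime d₀ q₀ ∧
          Nat.Coprime d₁ (r * qt) ∧ ((Nat.gcd d₀ d₁ : ℕ) : ℤ) ∣ Δ)) then
            g₀ d₀ * g₁ d₁ * Z d₀ d₁ else 0) =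
        ∑ d₁ ∈ (Ioc C (2 * C)).filter (fun d₁ => e ∣ d₁), (if (Nat.gcd d₀ d₁ = e ∧
          (Nat.Coprime d₀ q₀ ∧ Nat.Coprime d₁ (r * qt) ∧ ((Nat.gcd d₀ d₁ : ℕ) : ℤ) ∣ Δ)) then
            g₀ d₀ * g₁ d₁ * Z d₀ d₁ else 0) := by
      rw [Finset.sum_filter]
      refine Finset.sum_congr rfl fun d₁ _ => ?_
      by_cases hdiv : e ∣ d₁
      · rw [if_pos hdiv]
      · rw [if_neg hdiv, if_neg]
        rintro ⟨h1, -⟩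
        exact hdiv (h1 ▸ Nat.gcd_dvd_right d₀ d₁)
    have himage : (Ioc C (2 * C)).filter (fun d₁ => e ∣ d₁) =
        (Ioc (C / e) (2 * C / e)).image (fun m => e * m) := by
      ext d₁
      rw [Finset.mem_filter, Finset.mem_image]
      constructor
      · rintro ⟨hd₁, m, rfl⟩
        exact ⟨m, (mul_mem_Ioc_iff he0).1 hd₁, rfl⟩
      · rintro ⟨m, hm, rfl⟩
        exact ⟨(mul_mem_Ioc_iff he0).2 hm, Dvd.intro m rfl⟩
    have hinj : Set.InjOn (fun m => e * m) ↑(Ioc (C / e) (2 * C / e)) :=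
      fun m _ m' _ h => Nat.eq_of_mul_eq_mul_left he0 h
    rw [hsupp, himage, Finset.sum_image hinj]
    refine Finset.sum_congr rfl fun d₁' _ => ?_
    exact ite_gcd_sol_eq hqt hrs heΔ (fun hG => hg₁ _ fun h0 => hG (by rw [h0]; simp))
  rw [Finset.sum_congr rfl step2]
  -- Step 3: the factor `[gcd(e, q₁) = 1]` and the classes modulo `r`
  by_cases hecop : Nat.Coprime e (r * qt)
  swap
  · rw [if_neg hecop]
    refine Finset.sum_eq_zero fun d₀ _ => Finset.sum_eq_zero fun d₁' _ => ?_
    rw [if_neg]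
    rintro ⟨-, h2, -⟩
    exact hecop h2
  rw [if_pos hecop]
  -- restrict `d₀` to `e ∣ d₀` and `d₁'` to `gcd(d₁', r) = 1`
  have step3 : ∑ d₀ ∈ Ioc A (2 * A), ∑ d₁' ∈ Ioc (C / e) (2 * C / e),
      (if (e ∣ d₀ ∧ Nat.Coprime e (r * qt) ∧ Nat.Coprime d₁' r ∧
          Nat.Coprime (qt * d₀) (r * q₀ * d₁')) then g₀ d₀ * g₁ (e * d₁') * Z d₀ (e * d₁') else 0) =
      ∑ d₀ ∈ (Ioc A (2 * A)).filter (fun d => e ∣ d),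
        ∑ d₁' ∈ (Ioc (C / e) (2 * C / e)).filter (fun d => Nat.Coprime d r),
          (if Nat.Coprime (qt * d₀) (r * q₀ * d₁') then
            g₀ d₀ * g₁ (e * d₁') * Z d₀ (e * d₁') else 0) := by
    rw [Finset.sum_filter]
    refine Finset.sum_congr rfl fun d₀ _ => ?_
    by_cases hed₀ : e ∣ d₀
    · rw [if_pos hed₀, Finset.sum_filter]
      refine Finset.sum_congr rfl fun d₁' _ => ?_
      by_cases hc : Nat.Coprime d₁' r
      · rw [if_pos hc]
        by_cases hMN : Nat.Coprime (qt * d₀) (r * q₀ * d₁')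
        · rw [if_pos ⟨hed₀, hecop, hc, hMN⟩, if_pos hMN]
        · rw [if_neg hMN, if_neg]
          rintro ⟨-, -, -, h4⟩
          exact hMN h4
      · rw [if_neg hc, if_neg]
        rintro ⟨-, -, h3, -⟩
        exact hc h3
    · rw [if_neg hed₀]
      refine Finset.sum_eq_zero fun d₁' _ => ?_
      rw [if_neg]
      rintro ⟨h1, -⟩
      exact hed₀ h1
  rw [step3]
  -- classes of `d₀`
  rw [sum_eq_sum_range_filter_mod hr]
  refine Finset.sum_congr rfl fun c₀ _ => ?_
  rw [Finset.filter_filter]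
  -- classes of `d₁'` (inside), then swap
  have step4 : ∀ d₀ ∈ (Ioc A (2 * A)).filter (fun d => e ∣ d ∧ d % r = c₀),
      ∑ d₁' ∈ (Ioc (C / e) (2 * C / e)).filter (fun d => Nat.Coprime d r),
          (if Nat.Coprime (qt * d₀) (r * q₀ * d₁') then
            g₀ d₀ * g₁ (e * d₁') * Z d₀ (e * d₁') else 0) =
        ∑ c₁ ∈ Finset.range r,
          ∑ d₁' ∈ (Ioc (C / e) (2 * C / e)).filter (fun d => d % r = c₁ ∧ Nat.Coprime d r),
            (if Nat.Coprime (qt * d₀) (r * q₀ * d₁') then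
              g₀ d₀ * g₁ (e * d₁') * Z d₀ (e * d₁') else 0) := by
    intro d₀ _
    rw [sum_eq_sum_range_filter_mod hr]
    refine Finset.sum_congr rfl fun c₁ _ => ?_
    rw [Finset.filter_filter]
    refine Finset.sum_congr ?_ fun _ _ => rfl
    ext d
    simp only [Finset.mem_filter]
    tauto
  rw [Finset.sum_congr rfl step4, Finset.sum_comm]

/-- **The Duke–Friedlander–Iwaniec bound for one filtered piece of a dyadic box.**  With the
data of the file, `A ≥ 1`, `C ≥ D = |Δ|`, `e ∣ D` with `gcd(e, q₁) = 1`, classes `c₀, c₁ < r`,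
weights `|gᵢ| ≤ Gᵢ`, `k ≠ 0`, and a constant `K` / exponent `11/48 + ε` for which the bilinear
Kloosterman-fraction bound holds: the piece over `d₀ ∈ (A,2A]`, `e ∣ d₀`, `d₀ ≡ c₀`, and
`d₁' ∈ (C/e, 2C/e]`, `d₁' ≡ c₁`, `gcd(d₁', r) = 1`, is at most
`K (√A G₀)(√(2C) G₁)(1 + |k|(|y|+|a₀|)D/(AC)) (|k|D + q₀q₁AC)^{3/8} (q₀q₁(A+C))^{11/48+ε}`.
[folklore] -/
theorem norm_filteredPiece_le (hq₀ : 0 < q₀) (hqt : 0 < qt) (hr : 0 < r)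
    (hc₀ : IsCoprime (q₀ : ℤ) a₀) (hc₁ : IsCoprime ((r * qt : ℕ) : ℤ) a₁)
    (hΔ : ((r * qt : ℕ) : ℤ) * a₀ - (q₀ : ℤ) * a₁ ≠ 0)
    {A C : ℕ} (hA : 1 ≤ A) (hC : (((r * qt : ℕ) : ℤ) * a₀ - (q₀ : ℤ) * a₁).natAbs ≤ C)
    {e : ℕ} (he : e ∈ (((r * qt : ℕ) : ℤ) * a₀ - (q₀ : ℤ) * a₁).natAbs.divisors)
    (hecop : Nat.Coprime e (r * qt)) {c₀ c₁ : ℕ} (hc₀r : c₀ < r) (hc₁r : c₁ < r)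
    (ν : ℕ → ℕ → ℕ)
    (hν : ∀ d₀ d₁ : ℕ, 0 < d₀ → 0 < d₁ → Nat.Coprime d₀ q₀ → Nat.Coprime d₁ (r * qt) →
      ((Nat.gcd d₀ d₁ : ℕ) : ℤ) ∣ ((r * qt : ℕ) : ℤ) * a₀ - (q₀ : ℤ) * a₁ →
        (d₀ : ℤ) ∣ (q₀ : ℤ) * (ν d₀ d₁) + a₀ ∧ (d₁ : ℤ) ∣ ((r * qt : ℕ) : ℤ) * (ν d₀ d₁) + a₁)
    {k : ℤ} (hk : k ≠ 0) (y : ℝ) {G₀ G₁ : ℝ} (hG₀ : 0 ≤ G₀) (hG₁ : 0 ≤ G₁) (g₀ g₁ : ℕ → ℂ)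
    (hg₀ : ∀ d, ‖g₀ d‖ ≤ G₀) (hg₁ : ∀ d, ‖g₁ d‖ ≤ G₁)
    {K ε : ℝ} (hK : 0 ≤ K) (hε : 0 ≤ ε)
    (hDFI : ∀ (M N : ℝ), 1 / 2 ≤ M → 1 / 2 ≤ N → ∀ (k : ℤ), k ≠ 0 → ∀ (X : ℝ) (α β : ℕ → ℂ),
      (∀ m : ℕ, α m ≠ 0 → M < m ∧ (m : ℝ) ≤ 2 * M) →
      (∀ n : ℕ, β n ≠ 0 → N < n ∧ (n : ℝ) ≤ 2 * N) →
      ‖∑ m ∈ Finset.Icc 1 (Nat.floor (2 * M)), ∑ n ∈ Finset.Icc 1 (Nat.floor (2 * N)),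
          if Nat.Coprime m n then
            α m * β n * Complex.exp (2 * Real.pi * Complex.I *
              ((k : ℂ) * ((((m : ZMod n)⁻¹).val : ℕ) : ℂ) / (n : ℂ) + (X : ℂ) / ((m : ℂ) * n)))
          else 0‖ ≤
        K * Real.sqrt (∑ m ∈ Finset.Icc 1 (Nat.floor (2 * M)), ‖α m‖ ^ 2) *
          Real.sqrt (∑ n ∈ Finset.Icc 1 (Nat.floor (2 * N)), ‖β n‖ ^ 2) *
          (1 + |X| / (M * N)) * (|(k : ℝ)| + M * N) ^ (3 / 8 : ℝ) * (M + N) ^ (11 / 48 + ε)) :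
    ‖∑ d₀ ∈ (Ioc A (2 * A)).filter (fun d => e ∣ d ∧ d % r = c₀),
        ∑ d₁' ∈ (Ioc (C / e) (2 * C / e)).filter (fun d => d % r = c₁ ∧ Nat.Coprime d r),
          (if Nat.Coprime (qt * d₀) (r * q₀ * d₁') then
            g₀ d₀ * g₁ (e * d₁') * Complex.exp (2 * π * Complex.I *
              (((k : ℝ) * ((y - (ν d₀ (e * d₁') : ℝ)) / ((Nat.lcm d₀ (e * d₁') : ℕ) : ℝ)) : ℝ) : ℂ))
          else 0)‖ ≤
      K * (Real.sqrt A * G₀) * (Real.sqrt (2 * C) * G₁) *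
        (1 + |(k : ℝ)| * (|y| + |(a₀ : ℝ)|) * (((r * qt : ℕ) : ℤ) * a₀ - (q₀ : ℤ) * a₁).natAbs /
          ((A : ℝ) * C)) *
        (|(k : ℝ)| * (((r * qt : ℕ) : ℤ) * a₀ - (q₀ : ℤ) * a₁).natAbs +
          (q₀ : ℝ) * ((r * qt : ℕ) : ℝ) * A * C) ^ (3 / 8 : ℝ) *
        ((q₀ : ℝ) * ((r * qt : ℕ) : ℝ) * ((A : ℝ) + C)) ^ (11 / 48 + ε) := by
  classical
  have hD : 0 < ((((r * qt : ℕ) : ℤ) * a₀ - (q₀ : ℤ) * a₁)).natAbs := Int.natAbs_pos.2 hΔ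
  have hDR : (0 : ℝ) < ((((r * qt : ℕ) : ℤ) * a₀ - (q₀ : ℤ) * a₁)).natAbs := by exact_mod_cast hD
  have hAR : (1 : ℝ) ≤ A := by exact_mod_cast hA
  have hA0 : (0 : ℝ) < A := by linarith
  have hCD : ((((((r * qt : ℕ) : ℤ) * a₀ - (q₀ : ℤ) * a₁)).natAbs : ℕ) : ℝ) ≤ C := by exact_mod_cast hC
  have hC0 : (0 : ℝ) < C := lt_of_lt_of_le hDR hCD
  have hq0R : (1 : ℝ) ≤ q₀ := by exact_mod_cast hq₀
  have hrR : (0 : ℝ) < r := by exact_mod_cast hr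
  have hqtR : (0 : ℝ) < qt := by exact_mod_cast hqt
  have he0 : 0 < e := Nat.pos_of_mem_divisors he
  have heD : e ∣ ((((r * qt : ℕ) : ℤ) * a₀ - (q₀ : ℤ) * a₁)).natAbs := Nat.dvd_of_mem_divisors he
  have heΔ : (e : ℤ) ∣ (((r * qt : ℕ) : ℤ) * a₀ - (q₀ : ℤ) * a₁) := Int.natCast_dvd.2 heD
  have heR : (0 : ℝ) < e := by exact_mod_cast he0
  have heDR : (e : ℝ) ≤ ((((r * qt : ℕ) : ℤ) * a₀ - (q₀ : ℤ) * a₁)).natAbs := by exact_mod_cast Nat.le_of_dvd hD heD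
  have he1R : (1 : ℝ) ≤ e := by exact_mod_cast he0
  set I : Finset ℕ := (Ioc A (2 * A)).filter (fun d => e ∣ d ∧ d % r = c₀) with hIdef
  set J : Finset ℕ := (Ioc (C / e) (2 * C / e)).filter (fun d => d % r = c₁ ∧ Nat.Coprime d r)
    with hJdef
  have hI : ∀ d ∈ I, (A : ℝ) < d ∧ (d : ℝ) ≤ 2 * (A : ℝ) := by
    intro d hd
    rw [hIdef, Finset.mem_filter, Finset.mem_Ioc] at hd
    exact ⟨by exact_mod_cast hd.1.1, by exact_mod_cast hd.1.2⟩
  have hJ : ∀ d ∈ J, (C : ℝ) / e < d ∧ (d : ℝ) ≤ 2 * ((C : ℝ) / e) := by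
    intro d hd
    rw [hJdef, Finset.mem_filter, Finset.mem_Ioc] at hd
    obtain ⟨⟨h1, h2⟩, -⟩ := hd
    rw [Nat.div_lt_iff_lt_mul he0] at h1
    rw [Nat.le_div_iff_mul_le he0] at h2
    constructor
    · rw [div_lt_iff₀ heR]; exact_mod_cast h1
    · rw [mul_div_assoc', le_div_iff₀ heR]; exact_mod_cast h2
  have hIe : ∀ d ∈ I, e ∣ d := fun d hd => by
    rw [hIdef, Finset.mem_filter] at hd; exact hd.2.1
  have hIc : ∀ d ∈ I, d ≡ c₀ [MOD r] := fun d hd => by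
    rw [hIdef, Finset.mem_filter] at hd
    show d % r = c₀ % r
    rw [Nat.mod_eq_of_lt hc₀r]; exact hd.2.2
  have hJc : ∀ d ∈ J, d ≡ c₁ [MOD r] := fun d hd => by
    rw [hJdef, Finset.mem_filter] at hd
    show d % r = c₁ % r
    rw [Nat.mod_eq_of_lt hc₁r]; exact hd.2.1
  have hJr : ∀ d ∈ J, Nat.Coprime d r := fun d hd => by
    rw [hJdef, Finset.mem_filter] at hd; exact hd.2.2
  obtain ⟨w, hw⟩ : ∃ w : ℤ, Nat.Coprime (qt * c₀ * c₁) r →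
      w * ((qt * c₀ * c₁ : ℕ) : ℤ) ≡ 1 [ZMOD (r : ℕ)] := by
    by_cases hcw : Nat.Coprime (qt * c₀ * c₁) r
    · obtain ⟨w, hw⟩ := Int.mod_coprime hcw
      exact ⟨w, fun _ => by rw [mul_comm]; exact hw⟩
    · exact ⟨0, fun h => absurd h hcw⟩
  have hkΔ : k * (((r * qt : ℕ) : ℤ) * a₀ - (q₀ : ℤ) * a₁) ≠ 0 := mul_ne_zero hk hΔ
  have hP : (1 : ℝ) / 2 ≤ (A : ℝ) := by linarith
  have hQ : (1 : ℝ) / 2 ≤ (C : ℝ) / e := by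
    rw [le_div_iff₀ heR]; linarith
  have h := norm_piece_le hq₀ hqt hr he0 hc₀ hc₁ heΔ hecop hP hQ hI hJ hIe hIc hJc hJr hw ν hν
    g₀ (fun d => g₁ (e * d)) hkΔ y hDFI
  refine h.trans ?_
  -- the factors
  have hF1 : Real.sqrt (∑ d₀ ∈ I, ‖g₀ d₀‖ ^ 2) ≤ Real.sqrt A * G₀ := by
    have h1 : ∑ d₀ ∈ I, ‖g₀ d₀‖ ^ 2 ≤ (A : ℝ) * G₀ ^ 2 := by
      calc ∑ d₀ ∈ I, ‖g₀ d₀‖ ^ 2 ≤ ∑ _d₀ ∈ I, G₀ ^ 2 :=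
            Finset.sum_le_sum fun d _ => pow_le_pow_left₀ (norm_nonneg _) (hg₀ d) 2
        _ = (I.card : ℝ) * G₀ ^ 2 := by rw [Finset.sum_const, nsmul_eq_mul]
        _ ≤ (A : ℝ) * G₀ ^ 2 := by
            gcongr
            have : I.card ≤ (Ioc A (2 * A)).card := Finset.card_filter_le _ _
            rw [Nat.card_Ioc] at this
            exact_mod_cast (by omega : I.card ≤ A)
    calc Real.sqrt (∑ d₀ ∈ I, ‖g₀ d₀‖ ^ 2) ≤ Real.sqrt ((A : ℝ) * G₀ ^ 2) := Real.sqrt_le_sqrt h1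
      _ = Real.sqrt A * G₀ := by rw [Real.sqrt_mul hA0.le, Real.sqrt_sq hG₀]
  have hF2 : Real.sqrt (∑ d₁' ∈ J, ‖g₁ (e * d₁')‖ ^ 2) ≤ Real.sqrt (2 * C) * G₁ := by
    have h1 : ∑ d₁' ∈ J, ‖g₁ (e * d₁')‖ ^ 2 ≤ (2 * C : ℝ) * G₁ ^ 2 := by
      calc ∑ d₁' ∈ J, ‖g₁ (e * d₁')‖ ^ 2 ≤ ∑ _d₁' ∈ J, G₁ ^ 2 :=
            Finset.sum_le_sum fun d _ => pow_le_pow_left₀ (norm_nonneg _) (hg₁ _) 2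
        _ = (J.card : ℝ) * G₁ ^ 2 := by rw [Finset.sum_const, nsmul_eq_mul]
        _ ≤ (2 * C : ℝ) * G₁ ^ 2 := by
            gcongr
            have h3 : J.card ≤ (Ioc (C / e) (2 * C / e)).card := Finset.card_filter_le _ _
            rw [Nat.card_Ioc] at h3
            have h2 : 2 * C / e ≤ 2 * C := Nat.div_le_self _ _
            exact_mod_cast h3.trans ((Nat.sub_le _ _).trans h2)
    calc Real.sqrt (∑ d₁' ∈ J, ‖g₁ (e * d₁')‖ ^ 2) ≤ Real.sqrt ((2 * C : ℝ) * G₁ ^ 2) :=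
          Real.sqrt_le_sqrt h1
      _ = Real.sqrt (2 * C) * G₁ := by rw [Real.sqrt_mul (by positivity), Real.sqrt_sq hG₁]
  have hMN : (qt : ℝ) * A * ((r : ℝ) * q₀ * ((C : ℝ) / e)) =
      (q₀ : ℝ) * ((r * qt : ℕ) : ℝ) * A * C / e := by
    push_cast; field_simp
  have hF3 : 1 + |(k : ℝ) * (((r * qt : ℕ) : ℝ) * ((q₀ : ℝ) * y + (a₀ : ℝ)))| /
      ((qt : ℝ) * A * ((r : ℝ) * q₀ * ((C : ℝ) / e))) ≤
      1 + |(k : ℝ)| * (|y| + |(a₀ : ℝ)|) * ((((r * qt : ℕ) : ℤ) * a₀ - (q₀ : ℤ) * a₁)).natAbs / ((A : ℝ) * C) := by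
    rw [hMN]
    have hX : |(k : ℝ) * (((r * qt : ℕ) : ℝ) * ((q₀ : ℝ) * y + (a₀ : ℝ)))| ≤
        |(k : ℝ)| * (((r * qt : ℕ) : ℝ) * ((q₀ : ℝ) * (|y| + |(a₀ : ℝ)|))) := by
      rw [abs_mul]
      refine mul_le_mul_of_nonneg_left ?_ (abs_nonneg _)
      rw [abs_mul, abs_of_nonneg (by positivity : (0 : ℝ) ≤ ((r * qt : ℕ) : ℝ))]
      refine mul_le_mul_of_nonneg_left ?_ (by positivity)
      calc |(q₀ : ℝ) * y + a₀| ≤ |(q₀ : ℝ) * y| + |(a₀ : ℝ)| := abs_add_le _ _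
        _ = (q₀ : ℝ) * |y| + |(a₀ : ℝ)| := by
            rw [abs_mul, abs_of_nonneg (by positivity : (0 : ℝ) ≤ q₀)]
        _ ≤ (q₀ : ℝ) * |y| + q₀ * |(a₀ : ℝ)| := by
            have : (1 : ℝ) * |(a₀ : ℝ)| ≤ q₀ * |(a₀ : ℝ)| :=
              mul_le_mul_of_nonneg_right hq0R (abs_nonneg _)
            linarith
        _ = (q₀ : ℝ) * (|y| + |(a₀ : ℝ)|) := by ring
    have hden : 0 < (q₀ : ℝ) * ((r * qt : ℕ) : ℝ) * A * C / e := by positivity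
    refine add_le_add le_rfl ?_
    calc |(k : ℝ) * (((r * qt : ℕ) : ℝ) * ((q₀ : ℝ) * y + (a₀ : ℝ)))| /
          ((q₀ : ℝ) * ((r * qt : ℕ) : ℝ) * A * C / e)
        ≤ |(k : ℝ)| * (((r * qt : ℕ) : ℝ) * ((q₀ : ℝ) * (|y| + |(a₀ : ℝ)|))) /
          ((q₀ : ℝ) * ((r * qt : ℕ) : ℝ) * A * C / e) :=
          div_le_div_of_nonneg_right hX hden.le
      _ = |(k : ℝ)| * (|y| + |(a₀ : ℝ)|) * e / ((A : ℝ) * C) := by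
          field_simp
      _ ≤ |(k : ℝ)| * (|y| + |(a₀ : ℝ)|) * ((((r * qt : ℕ) : ℤ) * a₀ - (q₀ : ℤ) * a₁)).natAbs / ((A : ℝ) * C) := by
          gcongr
  have hF4 : |((-(k * (((r * qt : ℕ) : ℤ) * a₀ - (q₀ : ℤ) * a₁)) : ℤ) : ℝ)| + (qt : ℝ) * A * ((r : ℝ) * q₀ * ((C : ℝ) / e)) ≤
      |(k : ℝ)| * ((((r * qt : ℕ) : ℤ) * a₀ - (q₀ : ℤ) * a₁)).natAbs + (q₀ : ℝ) * ((r * qt : ℕ) : ℝ) * A * C := by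
    have h1 : |((-(k * (((r * qt : ℕ) : ℤ) * a₀ - (q₀ : ℤ) * a₁)) : ℤ) : ℝ)| = |(k : ℝ)| * ((((r * qt : ℕ) : ℤ) * a₀ - (q₀ : ℤ) * a₁)).natAbs := by
      rw [Nat.cast_natAbs, Int.cast_neg, Int.cast_mul, abs_neg, abs_mul, Int.cast_abs]
    rw [h1, hMN]
    refine add_le_add le_rfl ?_
    rw [div_le_iff₀ heR]
    have h0 : 0 ≤ (q₀ : ℝ) * ((r * qt : ℕ) : ℝ) * A * C := by positivity
    nlinarith
  have hF5 : (qt : ℝ) * A + (r : ℝ) * q₀ * ((C : ℝ) / e) ≤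
      (q₀ : ℝ) * ((r * qt : ℕ) : ℝ) * ((A : ℝ) + C) := by
    have h1 : (qt : ℝ) * A ≤ (q₀ : ℝ) * ((r * qt : ℕ) : ℝ) * A := by
      push_cast
      have hr1 : (1 : ℝ) ≤ r := by exact_mod_cast hr
      have h0 : (0 : ℝ) ≤ (qt : ℝ) * A := by positivity
      calc (qt : ℝ) * A = 1 * 1 * ((qt : ℝ) * A) := by ring
        _ ≤ (q₀ : ℝ) * r * ((qt : ℝ) * A) := by gcongr
        _ = (q₀ : ℝ) * (r * qt) * A := by ring
    have h2 : (r : ℝ) * q₀ * ((C : ℝ) / e) ≤ (q₀ : ℝ) * ((r * qt : ℕ) : ℝ) * C := by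
      rw [mul_div_assoc', div_le_iff₀ heR]
      push_cast
      have hqt1 : (1 : ℝ) ≤ qt := by exact_mod_cast hqt
      have h0 : 0 ≤ (r : ℝ) * q₀ * C := by positivity
      calc (r : ℝ) * q₀ * C = (r : ℝ) * q₀ * C * 1 * 1 := by ring
        _ ≤ (r : ℝ) * q₀ * C * qt * e := by gcongr
        _ = (q₀ : ℝ) * (r * qt) * C * e := by ring
    nlinarith
  have hb3 : 0 ≤ |((-(k * (((r * qt : ℕ) : ℤ) * a₀ - (q₀ : ℤ) * a₁)) : ℤ) : ℝ)| + (qt : ℝ) * A * ((r : ℝ) * q₀ * ((C : ℝ) / e)) := by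
    positivity
  have hb5 : 0 ≤ (qt : ℝ) * A + (r : ℝ) * q₀ * ((C : ℝ) / e) := by positivity
  have hε' : 0 ≤ 11 / 48 + ε := by linarith
  have hf3 : 0 ≤ 1 + |(k : ℝ) * (((r * qt : ℕ) : ℝ) * ((q₀ : ℝ) * y + (a₀ : ℝ)))| /
      ((qt : ℝ) * A * ((r : ℝ) * q₀ * ((C : ℝ) / e))) := by positivity
  exact mul6_le hK (Real.sqrt_nonneg _) (Real.sqrt_nonneg _) hf3 hb3 hb5 (by norm_num) hε'
    hF1 hF2 hF3 hF4 hF5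

/-- **The Duke–Friedlander–Iwaniec bound for a dyadic box.**  Summing `norm_filteredPiece_le`
over `e ∣ D` and the `r²` pairs of classes (`box_eq_sum_pieces`): for `A ≥ 1`, `C ≥ D = |Δ|`,
weights `|gᵢ| ≤ Gᵢ` with `g₁` supported on squarefree numbers, and `k ≠ 0`,
`‖Σ_{A<d₀≤2A} Σ_{C<d₁≤2C} [Sol] g₀(d₀)g₁(d₁) e(k(y − ν)/lcm(d₀,d₁))‖
  ≤ τ(D) r² K (√A G₀)(√(2C) G₁)(1 + |k|(|y|+|a₀|)D/(AC)) (|k|D + q₀q₁AC)^{3/8} (q₀q₁(A+C))^{11/48+ε}`.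
[folklore] -/
theorem norm_boxSum_le (hq₀ : 0 < q₀) (hqt : 0 < qt) (hr : 0 < r)
    (hqtc : Nat.Coprime qt (r * q₀)) (hrs : r ∣ q₀ ^ s)
    (hc₀ : IsCoprime (q₀ : ℤ) a₀) (hc₁ : IsCoprime ((r * qt : ℕ) : ℤ) a₁)
    (hΔ : ((r * qt : ℕ) : ℤ) * a₀ - (q₀ : ℤ) * a₁ ≠ 0)
    {A C : ℕ} (hA : 1 ≤ A) (hC : (((r * qt : ℕ) : ℤ) * a₀ - (q₀ : ℤ) * a₁).natAbs ≤ C)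
    (ν : ℕ → ℕ → ℕ)
    (hν : ∀ d₀ d₁ : ℕ, 0 < d₀ → 0 < d₁ → Nat.Coprime d₀ q₀ → Nat.Coprime d₁ (r * qt) →
      ((Nat.gcd d₀ d₁ : ℕ) : ℤ) ∣ ((r * qt : ℕ) : ℤ) * a₀ - (q₀ : ℤ) * a₁ →
        (d₀ : ℤ) ∣ (q₀ : ℤ) * (ν d₀ d₁) + a₀ ∧ (d₁ : ℤ) ∣ ((r * qt : ℕ) : ℤ) * (ν d₀ d₁) + a₁)
    {k : ℤ} (hk : k ≠ 0) (y : ℝ) {G₀ G₁ : ℝ} (hG₀ : 0 ≤ G₀) (hG₁ : 0 ≤ G₁) (g₀ g₁ : ℕ → ℂ)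
    (hg₀ : ∀ d, ‖g₀ d‖ ≤ G₀) (hg₁ : ∀ d, ‖g₁ d‖ ≤ G₁) (hg₁s : ∀ d, g₁ d ≠ 0 → Squarefree d)
    {K ε : ℝ} (hK : 0 ≤ K) (hε : 0 ≤ ε)
    (hDFI : ∀ (M N : ℝ), 1 / 2 ≤ M → 1 / 2 ≤ N → ∀ (k : ℤ), k ≠ 0 → ∀ (X : ℝ) (α β : ℕ → ℂ),
      (∀ m : ℕ, α m ≠ 0 → M < m ∧ (m : ℝ) ≤ 2 * M) →
      (∀ n : ℕ, β n ≠ 0 → N < n ∧ (n : ℝ) ≤ 2 * N) →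
      ‖∑ m ∈ Finset.Icc 1 (Nat.floor (2 * M)), ∑ n ∈ Finset.Icc 1 (Nat.floor (2 * N)),
          if Nat.Coprime m n then
            α m * β n * Complex.exp (2 * Real.pi * Complex.I *
              ((k : ℂ) * ((((m : ZMod n)⁻¹).val : ℕ) : ℂ) / (n : ℂ) + (X : ℂ) / ((m : ℂ) * n)))
          else 0‖ ≤
        K * Real.sqrt (∑ m ∈ Finset.Icc 1 (Nat.floor (2 * M)), ‖α m‖ ^ 2) *
          Real.sqrt (∑ n ∈ Finset.Icc 1 (Nat.floor (2 * N)), ‖β n‖ ^ 2) *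
          (1 + |X| / (M * N)) * (|(k : ℝ)| + M * N) ^ (3 / 8 : ℝ) * (M + N) ^ (11 / 48 + ε)) :
    ‖∑ d₀ ∈ Ioc A (2 * A), ∑ d₁ ∈ Ioc C (2 * C),
        (if (Nat.Coprime d₀ q₀ ∧ Nat.Coprime d₁ (r * qt) ∧
            ((Nat.gcd d₀ d₁ : ℕ) : ℤ) ∣ ((r * qt : ℕ) : ℤ) * a₀ - (q₀ : ℤ) * a₁) then
          g₀ d₀ * g₁ d₁ * Complex.exp (2 * π * Complex.I *
            (((k : ℝ) * ((y - (ν d₀ d₁ : ℝ)) / ((Nat.lcm d₀ d₁ : ℕ) : ℝ)) : ℝ) : ℂ))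
        else 0)‖ ≤
      ((((r * qt : ℕ) : ℤ) * a₀ - (q₀ : ℤ) * a₁).natAbs.divisors.card : ℝ) * (r : ℝ) ^ 2 *
        (K * (Real.sqrt A * G₀) * (Real.sqrt (2 * C) * G₁) *
          (1 + |(k : ℝ)| * (|y| + |(a₀ : ℝ)|) * (((r * qt : ℕ) : ℤ) * a₀ - (q₀ : ℤ) * a₁).natAbs /
            ((A : ℝ) * C)) *
          (|(k : ℝ)| * (((r * qt : ℕ) : ℤ) * a₀ - (q₀ : ℤ) * a₁).natAbs +
            (q₀ : ℝ) * ((r * qt : ℕ) : ℝ) * A * C) ^ (3 / 8 : ℝ) *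
          ((q₀ : ℝ) * ((r * qt : ℕ) : ℝ) * ((A : ℝ) + C)) ^ (11 / 48 + ε)) := by
  classical
  set PB : ℝ := K * (Real.sqrt A * G₀) * (Real.sqrt (2 * C) * G₁) *
      (1 + |(k : ℝ)| * (|y| + |(a₀ : ℝ)|) * ((((r * qt : ℕ) : ℤ) * a₀ - (q₀ : ℤ) * a₁)).natAbs / ((A : ℝ) * C)) *
      (|(k : ℝ)| * ((((r * qt : ℕ) : ℤ) * a₀ - (q₀ : ℤ) * a₁)).natAbs + (q₀ : ℝ) * ((r * qt : ℕ) : ℝ) * A * C) ^ (3 / 8 : ℝ) *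
      ((q₀ : ℝ) * ((r * qt : ℕ) : ℝ) * ((A : ℝ) + C)) ^ (11 / 48 + ε) with hPBdef
  have hPB0 : 0 ≤ PB := by rw [hPBdef]; positivity
  rw [box_eq_sum_pieces hr hqtc hrs hΔ A C g₀ g₁ hg₁s]
  refine (norm_sum_le _ _).trans ?_
  calc ∑ e ∈ ((((r * qt : ℕ) : ℤ) * a₀ - (q₀ : ℤ) * a₁)).natAbs.divisors, ‖(if Nat.Coprime e (r * qt) then
        ∑ c₀ ∈ Finset.range r, ∑ c₁ ∈ Finset.range r,
          ∑ d₀ ∈ (Ioc A (2 * A)).filter (fun d => e ∣ d ∧ d % r = c₀),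
            ∑ d₁' ∈ (Ioc (C / e) (2 * C / e)).filter (fun d => d % r = c₁ ∧ Nat.Coprime d r),
              (if Nat.Coprime (qt * d₀) (r * q₀ * d₁') then
                g₀ d₀ * g₁ (e * d₁') * Complex.exp (2 * π * Complex.I *
                  (((k : ℝ) * ((y - (ν d₀ (e * d₁') : ℝ)) /
                    ((Nat.lcm d₀ (e * d₁') : ℕ) : ℝ)) : ℝ) : ℂ)) else 0) else 0)‖
      ≤ ∑ _e ∈ ((((r * qt : ℕ) : ℤ) * a₀ - (q₀ : ℤ) * a₁)).natAbs.divisors, (r : ℝ) ^ 2 * PB := by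
        refine Finset.sum_le_sum fun e he => ?_
        by_cases hecop : Nat.Coprime e (r * qt)
        · rw [if_pos hecop]
          refine (norm_sum_le _ _).trans ?_
          calc ∑ c₀ ∈ Finset.range r, ‖∑ c₁ ∈ Finset.range r,
                ∑ d₀ ∈ (Ioc A (2 * A)).filter (fun d => e ∣ d ∧ d % r = c₀),
                  ∑ d₁' ∈ (Ioc (C / e) (2 * C / e)).filter (fun d => d % r = c₁ ∧ Nat.Coprime d r),
                    (if Nat.Coprime (qt * d₀) (r * q₀ * d₁') then
                      g₀ d₀ * g₁ (e * d₁') * Complex.exp (2 * π * Complex.I *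
                        (((k : ℝ) * ((y - (ν d₀ (e * d₁') : ℝ)) /
                          ((Nat.lcm d₀ (e * d₁') : ℕ) : ℝ)) : ℝ) : ℂ)) else 0)‖
              ≤ ∑ c₀ ∈ Finset.range r, ∑ c₁ ∈ Finset.range r, PB := by
                refine Finset.sum_le_sum fun c₀ hc₀m => (norm_sum_le _ _).trans ?_
                refine Finset.sum_le_sum fun c₁ hc₁m => ?_
                rw [Finset.mem_range] at hc₀m hc₁m
                exact norm_filteredPiece_le hq₀ hqt hr hc₀ hc₁ hΔ hA hC he hecop hc₀m hc₁m ν hν hk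
                  y hG₀ hG₁ g₀ g₁ hg₀ hg₁ hK hε hDFI
            _ = (r : ℝ) ^ 2 * PB := by
                rw [Finset.sum_const, Finset.card_range, nsmul_eq_mul, Finset.sum_const,
                  Finset.card_range, nsmul_eq_mul]
                ring
        · rw [if_neg hecop, norm_zero]
          positivity
    _ = ((((((r * qt : ℕ) : ℤ) * a₀ - (q₀ : ℤ) * a₁)).natAbs.divisors.card : ℕ) : ℝ) * (r : ℝ) ^ 2 * PB := by
        rw [Finset.sum_const, nsmul_eq_mul]; ring

/-! ### Separation of the window `Y' < d₀ d₁ ≤ Y` -/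

/-- The window indicator as a Duke–Friedlander–Iwaniec integral: for `1 ≤ Y' ≤ Y` and a positive
integer `m`, `[Y' < m ≤ Y] = ∫ (h_Y − h_{Y'})(t) m^{it} dt` (`FriedlanderIwaniecPrimes.lemma261`).
[folklore] -/
theorem window_indicator_eq_integral {Y Y' : ℝ} (hY' : 1 ≤ Y') (hYY : Y' ≤ Y) {m : ℕ} (hm : 1 ≤ m) :
    (if (Y' < (m : ℝ) ∧ (m : ℝ) ≤ Y) then (1 : ℂ) else 0) =
      ∫ t : ℝ, (FriedlanderIwaniecPrimes.sepFun Y t - FriedlanderIwaniecPrimes.sepFun Y' t) *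
        Complex.exp (Complex.I * t * Real.log m) := by
  have hY : 1 ≤ Y := hY'.trans hYY
  obtain ⟨hintY, -, hidY⟩ := FriedlanderIwaniecPrimes.lemma261 hY
  obtain ⟨hintY', -, hidY'⟩ := FriedlanderIwaniecPrimes.lemma261 hY'
  have hE1 : ∀ t : ℝ, ‖Complex.exp (Complex.I * t * Real.log m)‖ = 1 := fun t => by
    rw [show Complex.I * t * Real.log m = ((t * Real.log m : ℝ) : ℂ) * Complex.I by
      push_cast; ring]
    exact Complex.norm_exp_ofReal_mul_I _
  have hcont : Continuous fun t : ℝ => Complex.exp (Complex.I * t * Real.log m) := by fun_prop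
  have hi1 : Integrable fun t => FriedlanderIwaniecPrimes.sepFun Y t *
      Complex.exp (Complex.I * t * Real.log m) :=
    hintY.mul_bdd hcont.aestronglyMeasurable (ae_of_all _ fun t => (hE1 t).le)
  have hi2 : Integrable fun t => FriedlanderIwaniecPrimes.sepFun Y' t *
      Complex.exp (Complex.I * t * Real.log m) :=
    hintY'.mul_bdd hcont.aestronglyMeasurable (ae_of_all _ fun t => (hE1 t).le)
  simp_rw [sub_mul]
  rw [integral_sub hi1 hi2, hidY m hm, hidY' m hm]
  by_cases h1 : (m : ℝ) ≤ Y
  · by_cases h2 : (m : ℝ) ≤ Y'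
    · rw [if_pos h1, if_pos h2, if_neg (fun h => absurd h2 (not_le.2 h.1)), sub_self]
    · rw [if_pos h1, if_neg h2, if_pos ⟨not_le.1 h2, h1⟩, sub_zero]
  · have h2 : ¬ (m : ℝ) ≤ Y' := fun h => h1 (h.trans hYY)
    rw [if_neg h1, if_neg h2, if_neg (fun h => h1 h.2), sub_zero]

/-- **The windowed box sum.**  For `1 ≤ Y' ≤ Y`, the box sum with the extra product condition
`Y' < d₀ d₁ ≤ Y` is at most `log(6Y) + log(6Y')` times the bound of `norm_boxSum_le`: write
`[Y' < d₀d₁ ≤ Y] = ∫ (h_Y − h_{Y'})(t) (d₀d₁)^{it} dt` (`∫ |h_Y| < log 6Y`,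
`FriedlanderIwaniecPrimes.lemma261`), move the integral outside, absorb `dᵢ^{it}` into the weights
(same sizes, same squarefree support) and apply `norm_boxSum_le` for every `t`. [folklore] -/
theorem norm_windowBoxSum_le (hq₀ : 0 < q₀) (hqt : 0 < qt) (hr : 0 < r)
    (hqtc : Nat.Coprime qt (r * q₀)) (hrs : r ∣ q₀ ^ s)
    (hc₀ : IsCoprime (q₀ : ℤ) a₀) (hc₁ : IsCoprime ((r * qt : ℕ) : ℤ) a₁)
    (hΔ : (((r * qt : ℕ) : ℤ) * a₀ - (q₀ : ℤ) * a₁) ≠ 0) {A C : ℕ} (hA : 1 ≤ A) (hC : ((((r * qt : ℕ) : ℤ) * a₀ - (q₀ : ℤ) * a₁)).natAbs ≤ C)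
    (ν : ℕ → ℕ → ℕ)
    (hν : ∀ d₀ d₁ : ℕ, 0 < d₀ → 0 < d₁ → Nat.Coprime d₀ q₀ → Nat.Coprime d₁ (r * qt) →
      ((Nat.gcd d₀ d₁ : ℕ) : ℤ) ∣ (((r * qt : ℕ) : ℤ) * a₀ - (q₀ : ℤ) * a₁) →
        (d₀ : ℤ) ∣ (q₀ : ℤ) * (ν d₀ d₁) + a₀ ∧ (d₁ : ℤ) ∣ ((r * qt : ℕ) : ℤ) * (ν d₀ d₁) + a₁)
    {k : ℤ} (hk : k ≠ 0) (y : ℝ) {G₀ G₁ : ℝ} (hG₀ : 0 ≤ G₀) (hG₁ : 0 ≤ G₁) (h₀ h₁ : ℕ → ℂ)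
    (hh₀ : ∀ d, ‖h₀ d‖ ≤ G₀) (hh₁ : ∀ d, ‖h₁ d‖ ≤ G₁) (hh₁s : ∀ d, h₁ d ≠ 0 → Squarefree d)
    {K ε : ℝ} (hK : 0 ≤ K) (hε : 0 ≤ ε)
    (hDFI : ∀ (M N : ℝ), 1 / 2 ≤ M → 1 / 2 ≤ N → ∀ (k : ℤ), k ≠ 0 → ∀ (X : ℝ) (α β : ℕ → ℂ),
      (∀ m : ℕ, α m ≠ 0 → M < m ∧ (m : ℝ) ≤ 2 * M) →
      (∀ n : ℕ, β n ≠ 0 → N < n ∧ (n : ℝ) ≤ 2 * N) →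
      ‖∑ m ∈ Finset.Icc 1 (Nat.floor (2 * M)), ∑ n ∈ Finset.Icc 1 (Nat.floor (2 * N)),
          if Nat.Coprime m n then
            α m * β n * Complex.exp (2 * Real.pi * Complex.I *
              ((k : ℂ) * ((((m : ZMod n)⁻¹).val : ℕ) : ℂ) / (n : ℂ) + (X : ℂ) / ((m : ℂ) * n)))
          else 0‖ ≤
        K * Real.sqrt (∑ m ∈ Finset.Icc 1 (Nat.floor (2 * M)), ‖α m‖ ^ 2) *
          Real.sqrt (∑ n ∈ Finset.Icc 1 (Nat.floor (2 * N)), ‖β n‖ ^ 2) *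
          (1 + |X| / (M * N)) * (|(k : ℝ)| + M * N) ^ (3 / 8 : ℝ) * (M + N) ^ (11 / 48 + ε))
    {Y Y' : ℝ} (hY' : 1 ≤ Y') (hYY : Y' ≤ Y) :
    ‖∑ d₀ ∈ Ioc A (2 * A), ∑ d₁ ∈ Ioc C (2 * C),
        (if ((Nat.Coprime d₀ q₀ ∧ Nat.Coprime d₁ (r * qt) ∧ ((Nat.gcd d₀ d₁ : ℕ) : ℤ) ∣ (((r * qt : ℕ) : ℤ) * a₀ - (q₀ : ℤ) * a₁)) ∧
            (Y' < (d₀ : ℝ) * d₁ ∧ (d₀ : ℝ) * d₁ ≤ Y)) then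
          h₀ d₀ * h₁ d₁ * Complex.exp (2 * π * Complex.I *
            (((k : ℝ) * ((y - (ν d₀ d₁ : ℝ)) / ((Nat.lcm d₀ d₁ : ℕ) : ℝ)) : ℝ) : ℂ))
        else 0)‖ ≤
      (Real.log (6 * Y) + Real.log (6 * Y')) *
        (((((((r * qt : ℕ) : ℤ) * a₀ - (q₀ : ℤ) * a₁)).natAbs.divisors.card : ℕ) : ℝ) * (r : ℝ) ^ 2 *
          (K * (Real.sqrt A * G₀) * (Real.sqrt (2 * C) * G₁) *
            (1 + |(k : ℝ)| * (|y| + |(a₀ : ℝ)|) * ((((r * qt : ℕ) : ℤ) * a₀ - (q₀ : ℤ) * a₁)).natAbs / ((A : ℝ) * C)) *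
            (|(k : ℝ)| * ((((r * qt : ℕ) : ℤ) * a₀ - (q₀ : ℤ) * a₁)).natAbs + (q₀ : ℝ) * ((r * qt : ℕ) : ℝ) * A * C) ^ (3 / 8 : ℝ) *
            ((q₀ : ℝ) * ((r * qt : ℕ) : ℝ) * ((A : ℝ) + C)) ^ (11 / 48 + ε))) := by
  classical
  have hY : 1 ≤ Y := hY'.trans hYY
  obtain ⟨hintY, hnormY, -⟩ := FriedlanderIwaniecPrimes.lemma261 hY
  obtain ⟨hintY', hnormY', -⟩ := FriedlanderIwaniecPrimes.lemma261 hY'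
  set H : ℝ → ℂ := fun t => FriedlanderIwaniecPrimes.sepFun Y t -
    FriedlanderIwaniecPrimes.sepFun Y' t with hHdef
  have hHint : Integrable H := hintY.sub hintY'
  set B : ℝ := ((((((r * qt : ℕ) : ℤ) * a₀ - (q₀ : ℤ) * a₁)).natAbs.divisors.card : ℕ) : ℝ) * (r : ℝ) ^ 2 *
      (K * (Real.sqrt A * G₀) * (Real.sqrt (2 * C) * G₁) *
        (1 + |(k : ℝ)| * (|y| + |(a₀ : ℝ)|) * ((((r * qt : ℕ) : ℤ) * a₀ - (q₀ : ℤ) * a₁)).natAbs / ((A : ℝ) * C)) *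
        (|(k : ℝ)| * ((((r * qt : ℕ) : ℤ) * a₀ - (q₀ : ℤ) * a₁)).natAbs + (q₀ : ℝ) * ((r * qt : ℕ) : ℝ) * A * C) ^ (3 / 8 : ℝ) *
        ((q₀ : ℝ) * ((r * qt : ℕ) : ℝ) * ((A : ℝ) + C)) ^ (11 / 48 + ε)) with hBdef
  have hB0 : 0 ≤ B := by rw [hBdef]; positivity
  -- notation for the pieces of the summand
  set Sol : ℕ → ℕ → Prop := fun d₀ d₁ =>
    Nat.Coprime d₀ q₀ ∧ Nat.Coprime d₁ (r * qt) ∧ ((Nat.gcd d₀ d₁ : ℕ) : ℤ) ∣ (((r * qt : ℕ) : ℤ) * a₀ - (q₀ : ℤ) * a₁) with hSol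
  set ph : ℕ → ℕ → ℂ := fun d₀ d₁ => Complex.exp (2 * π * Complex.I *
    (((k : ℝ) * ((y - (ν d₀ d₁ : ℝ)) / ((Nat.lcm d₀ d₁ : ℕ) : ℝ)) : ℝ) : ℂ)) with hph
  set E : ℕ → ℝ → ℂ := fun m t => Complex.exp (Complex.I * t * Real.log m) with hE
  have hE1 : ∀ m t, ‖E m t‖ = 1 := fun m t => by
    simp only [hE]
    rw [show Complex.I * t * Real.log m = ((t * Real.log m : ℝ) : ℂ) * Complex.I by
      push_cast; ring]
    exact Complex.norm_exp_ofReal_mul_I _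
  have hEcont : ∀ m, Continuous (E m) := fun m => by simp only [hE]; fun_prop
  -- the twisted box sums are bounded by `B`
  have hbox : ∀ t : ℝ, ‖∑ d₀ ∈ Ioc A (2 * A), ∑ d₁ ∈ Ioc C (2 * C),
      (if Sol d₀ d₁ then (h₀ d₀ * E d₀ t) * (h₁ d₁ * E d₁ t) * ph d₀ d₁ else 0)‖ ≤ B := by
    intro t
    have hg₀ : ∀ d, ‖h₀ d * E d t‖ ≤ G₀ := fun d => by rw [norm_mul, hE1, mul_one]; exact hh₀ d
    have hg₁ : ∀ d, ‖h₁ d * E d t‖ ≤ G₁ := fun d => by rw [norm_mul, hE1, mul_one]; exact hh₁ d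
    have hg₁s : ∀ d, h₁ d * E d t ≠ 0 → Squarefree d := fun d hd =>
      hh₁s d (mul_ne_zero_iff.1 hd).1
    exact norm_boxSum_le hq₀ hqt hr hqtc hrs hc₀ hc₁ hΔ hA hC ν hν hk y hG₀ hG₁
      (fun d => h₀ d * E d t) (fun d => h₁ d * E d t) hg₀ hg₁ hg₁s hK hε hDFI
  -- Step 1: every term is an integral
  have hterm : ∀ d₀ ∈ Ioc A (2 * A), ∀ d₁ ∈ Ioc C (2 * C),
      (if (Sol d₀ d₁ ∧ (Y' < (d₀ : ℝ) * d₁ ∧ (d₀ : ℝ) * d₁ ≤ Y)) then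
          h₀ d₀ * h₁ d₁ * ph d₀ d₁ else 0) =
        ∫ t : ℝ, (if Sol d₀ d₁ then h₀ d₀ * h₁ d₁ * ph d₀ d₁ else 0) * (H t * E (d₀ * d₁) t) := by
    intro d₀ hd₀ d₁ hd₁
    have hd₀pos : 0 < d₀ := pos_of_gt (Finset.mem_Ioc.1 hd₀).1
    have hd₁pos : 0 < d₁ := pos_of_gt (Finset.mem_Ioc.1 hd₁).1
    have hm : 1 ≤ d₀ * d₁ := Nat.mul_pos hd₀pos hd₁pos
    rw [integral_const_mul]
    have hind : (if (Y' < (d₀ : ℝ) * d₁ ∧ (d₀ : ℝ) * d₁ ≤ Y) then (1 : ℂ) else 0) =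
        ∫ t : ℝ, (FriedlanderIwaniecPrimes.sepFun Y t - FriedlanderIwaniecPrimes.sepFun Y' t) *
          Complex.exp (Complex.I * t * Real.log ((d₀ * d₁ : ℕ) : ℝ)) := by
      rw [← window_indicator_eq_integral hY' hYY hm]; norm_cast
    simp only [hE, hHdef]
    rw [← hind]
    by_cases hs : Sol d₀ d₁
    · by_cases hw : Y' < (d₀ : ℝ) * d₁ ∧ (d₀ : ℝ) * d₁ ≤ Y
      · rw [if_pos ⟨hs, hw⟩, if_pos hs, if_pos hw, mul_one]
      · rw [if_neg (fun h => hw h.2), if_neg hw, mul_zero]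
    · rw [if_neg (fun h => hs h.1), if_neg hs, zero_mul]
  -- integrability of the terms
  have hint : ∀ d₀ d₁ : ℕ, Integrable fun t : ℝ =>
      (if Sol d₀ d₁ then h₀ d₀ * h₁ d₁ * ph d₀ d₁ else 0) * (H t * E (d₀ * d₁) t) := by
    intro d₀ d₁
    refine Integrable.const_mul ?_ _
    exact hHint.mul_bdd (hEcont _).aestronglyMeasurable (ae_of_all _ fun t => (hE1 _ t).le)
  -- Step 2: swap sum and integral
  have hswap : ∑ d₀ ∈ Ioc A (2 * A), ∑ d₁ ∈ Ioc C (2 * C),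
      (if (Sol d₀ d₁ ∧ (Y' < (d₀ : ℝ) * d₁ ∧ (d₀ : ℝ) * d₁ ≤ Y)) then
          h₀ d₀ * h₁ d₁ * ph d₀ d₁ else 0) =
      ∫ t : ℝ, ∑ d₀ ∈ Ioc A (2 * A), ∑ d₁ ∈ Ioc C (2 * C),
        (if Sol d₀ d₁ then h₀ d₀ * h₁ d₁ * ph d₀ d₁ else 0) * (H t * E (d₀ * d₁) t) := by
    rw [integral_finsetSum _ fun d₀ _ => integrable_finsetSum _ fun d₁ _ => hint d₀ d₁]
    refine Finset.sum_congr rfl fun d₀ hd₀ => ?_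
    rw [integral_finsetSum _ fun d₁ _ => hint d₀ d₁]
    exact Finset.sum_congr rfl fun d₁ hd₁ => hterm d₀ hd₀ d₁ hd₁
  -- Step 3: the integrand is `H(t)` times a twisted box sum
  have hintegrand : ∀ t : ℝ, ∑ d₀ ∈ Ioc A (2 * A), ∑ d₁ ∈ Ioc C (2 * C),
      (if Sol d₀ d₁ then h₀ d₀ * h₁ d₁ * ph d₀ d₁ else 0) * (H t * E (d₀ * d₁) t) =
      H t * ∑ d₀ ∈ Ioc A (2 * A), ∑ d₁ ∈ Ioc C (2 * C),
        (if Sol d₀ d₁ then (h₀ d₀ * E d₀ t) * (h₁ d₁ * E d₁ t) * ph d₀ d₁ else 0) := by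
    intro t
    rw [Finset.mul_sum]
    refine Finset.sum_congr rfl fun d₀ hd₀ => ?_
    rw [Finset.mul_sum]
    refine Finset.sum_congr rfl fun d₁ hd₁ => ?_
    have hd₀pos : 0 < d₀ := pos_of_gt (Finset.mem_Ioc.1 hd₀).1
    have hd₁pos : 0 < d₁ := pos_of_gt (Finset.mem_Ioc.1 hd₁).1
    have hEmul : E (d₀ * d₁) t = E d₀ t * E d₁ t := by
      simp only [hE]
      rw [← Complex.exp_add]
      congr 1
      push_cast
      rw [Real.log_mul (by exact_mod_cast hd₀pos.ne') (by exact_mod_cast hd₁pos.ne')]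
      push_cast
      ring
    rw [hEmul]
    by_cases hs : Sol d₀ d₁
    · rw [if_pos hs, if_pos hs]; ring
    · rw [if_neg hs, if_neg hs, zero_mul, mul_zero]
  rw [hswap]
  simp_rw [hintegrand]
  -- Step 4: bound the integral
  have hle : ∀ t : ℝ, ‖H t * ∑ d₀ ∈ Ioc A (2 * A), ∑ d₁ ∈ Ioc C (2 * C),
      (if Sol d₀ d₁ then (h₀ d₀ * E d₀ t) * (h₁ d₁ * E d₁ t) * ph d₀ d₁ else 0)‖ ≤
      ‖H t‖ * B := fun t => by
    rw [norm_mul]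
    exact mul_le_mul_of_nonneg_left (hbox t) (norm_nonneg _)
  refine (norm_integral_le_of_norm_le (hHint.norm.mul_const B) (ae_of_all _ hle)).trans ?_
  rw [integral_mul_const]
  refine mul_le_mul_of_nonneg_right ?_ hB0
  -- `∫ ‖H‖ ≤ ∫ ‖h_Y‖ + ∫ ‖h_{Y'}‖ < log 6Y + log 6Y'`
  have h1 : ∫ t, ‖H t‖ ≤ ∫ t, (‖FriedlanderIwaniecPrimes.sepFun Y t‖ +
      ‖FriedlanderIwaniecPrimes.sepFun Y' t‖) :=
    integral_mono hHint.norm (hintY.norm.add hintY'.norm) fun t => norm_sub_le _ _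
  rw [integral_add hintY.norm hintY'.norm] at h1
  linarith

end Box

end Literature.NumberTheory.Sieve.LinearPairKloosterman
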